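import Summits.ValiantsHypothesis.ValiantsHypothesis.Theorems.LacunarySymmetroidMatrixDescartesFiniteSectorSectorCeilingFourSixA
import Summits.ValiantsHypothesis.ValiantsHypothesis.Theorems.LacunarySymmetroidMatrixDescartesFiniteSectorSectorCeilingFourSixB
import Summits.ValiantsHypothesis.ValiantsHypothesis.Theorems.LacunarySymmetroidMatrixDescartesFiniteSectorSectorCeilingFourSixC
import Summits.ValiantsHypothesis.ValiantsHypothesis.Theorems.LacunarySymmetroidMatrixDescartesFiniteSectorSectorCeilingFourSixD
import Summits.ValiantsHypothesis.ValiantsHypothesis.Theorems.LacunarySymmetroidMatrixDescartesFiniteSectorSectorCeilingFourSixE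
import Summits.ValiantsHypothesis.ValiantsHypothesis.Theorems.LacunarySymmetroidMatrixDescartesFiniteSectorSumMasksHigher

/-!
# `MatrixDescartes` — line «finite»: the SECTOR CEILING `η(4,6) ≤ σ(4,6) = 140` (kernel) — `HypRootLawAt 4 6 140`, Conjecture Σ's value
# `2·n(4,5)` at the cell `(4,6)`

HONEST FRAMING.  Object-search cell `pub-symmetroid`, seat val-sym-door-p5 g8.  HELPER of the crux item `stmt-ValiantsHypothesis-18050` with NO closure claim.  The SIEVE of
line «finite» (`FiniteSector.sieve`, `natDegree_mem_sumset`) makes the `4`-fold sums of exponents of an in-sector pencil a step-≤-2 chain from `0` up to the degree;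
the finite core — no `5` positive values carry such a chain beyond `140` — has 76920 live prefixes and is decided in the kernel in SLICES by the two smallest positive
values `(a,b)` (`a ≤ 2` and `b ≤ 4a + 2` are forced by the chain at `r = 1` and `r = 4a + 1`): slices (1,2), (1,3), (1,4), (1,5), (1,6), (2,3), (2,4), (2,5), (2,6), (2,7), (2,8), (2,9), (2,10) in
`…FiniteSectorSectorCeilingFourSixA`, `…FiniteSectorSectorCeilingFourSixB`, `…FiniteSectorSectorCeilingFourSixC`, `…FiniteSectorSectorCeilingFourSixD`, `…FiniteSectorSectorCeilingFourSixE` (this file holds the transfer only); `4`-fold sums as iterated shift-form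
bitmasks (`…FiniteSectorSumMasksHigher`).  Result: `hypRootLawAt_four_six_140 : HypRootLawAt 4 6 140`.  Located first (exact DFS, this seat, HOME/val-sym-door-p5/g8/work/mask/psenum_m.py):
the chain survives to `139` only on the doubled extremal basis `2·{0,1,3,11,15,32}` — `σ(4,6) = 140 = 2·n(4,5)`, Conjecture Σ of `Lines/finite.md` at the NEW cell `(4,6)`; the lower
side needs a realised doubled basis and is NOT claimed here.  Nothing here bears on the crux (asymptotic), on `H3`, on the doors, or on `VP ≠ VNP`.
[folklore] Gap-rule / sieve bookkeeping plus a finite enumeration (postage-stamp numbers); no citation is load-bearing.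
-/

-- `Summit.ValiantsHypothesis.ValiantsHypothesis.…` repeats a component by the D-0017 layout
-- (single-conjunct summit), which the `dupNamespace` linter flags; the name is mandated.
set_option linter.dupNamespace false

namespace Summit.ValiantsHypothesis.ValiantsHypothesis.Theorems.LacunarySymmetroidMatrixDescartes.FiniteSector

open scoped BigOperators Matrix
open Polynomial

/-! ## `(4,6)`: `σ(4,6) = 140` — the transfer -/


/-- **`η(4,6) ≤ 140 = σ(4,6)`** — `HypRootLawAt 4 6 140`: every in-sector (`#distinct real roots = natDegree`) determinant of a real symmetric
`4 × 4` lacunary pencil with `6` terms has degree `≤ 140` (SIEVE ⇒ `4`-fold-sum chain; values capped at `143`, padded, sorted; `a ≤ 2`, `b ≤ 4a + 2`;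
prefix pruning; bitmasks; the slice checks). [folklore] -/
theorem hypRootLawAt_four_six_140 : HypRootLawAt 4 6 140 := by
  intro d S hS hsec
  by_contra hdeg'
  have hdeg : 140 < (pencil d S).det.natDegree := not_le.mp hdeg'
  have hq : (pencil d S).det ≠ 0 := by
    intro h0
    rw [h0] at hdeg
    simp at hdeg
  have hpair : ∀ r, r ∈ (Finset.univ : Finset (Sym (Fin 6) 4)).image
      (fun s : Sym (Fin 6) 4 => ((s : Multiset (Fin 6)).map d).sum) → ∃ i j k l : Fin 6, d i + d j + d k + d l = r := by
    intro r hr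
    rw [Finset.mem_image] at hr
    obtain ⟨s, -, hs⟩ := hr
    obtain ⟨i, j, k, l, h4⟩ := exists_sum_eq_of_card_four d (s : Multiset (Fin 6)) s.2
    exact ⟨i, j, k, l, by omega⟩
  have hchain : ∀ r, r + 2 ≤ (pencil d S).det.natDegree →
      (∃ i j k l : Fin 6, d i + d j + d k + d l = r) ∨ (∃ i j k l : Fin 6, d i + d j + d k + d l = r + 1) := by
    intro r hr
    rcases sieve d S hq hsec hr with h | h
    · exact Or.inl (hpair _ h)
    · exact Or.inr (hpair _ h)
  have htop : ∃ i j k l : Fin 6, d i + d j + d k + d l = (pencil d S).det.natDegree := hpair _ (natDegree_mem_sumset d S hq)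
  set cv : Fin 6 → ℕ := fun i => min (d i) 143 with hcv
  have hcvd : ∀ i, d i ≤ 142 → cv i = d i := fun i hi => by
    simp only [hcv]
    exact Nat.min_eq_left (by omega)
  have hcvle : ∀ i, cv i ≤ 143 := fun i => Nat.min_le_right _ _
  set V : Finset ℕ := Finset.univ.image cv with hV
  have hcvV : ∀ i, cv i ∈ V := fun i => Finset.mem_image_of_mem cv (Finset.mem_univ i)
  have h0V : 0 ∈ V := by
    have key : ∃ i : Fin 6, d i = 0 := by
      rcases hchain 0 (by omega) with ⟨i, j, k, l, hh⟩ | ⟨i, j, k, l, hh⟩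
      · exact ⟨i, by omega⟩
      · rcases Nat.eq_zero_or_pos (d i) with hi | hi
        · exact ⟨i, hi⟩
        · exact ⟨j, by omega⟩
    obtain ⟨i, hi⟩ := key
    have : cv i = 0 := by rw [hcvd i (by omega)]; omega
    exact this ▸ hcvV i
  set W : Finset ℕ := V.erase 0 with hW
  have hWsub : W ⊆ (Finset.range 144).erase 0 := by
    intro u hu
    rw [hW, Finset.mem_erase] at hu
    obtain ⟨hu0, huV⟩ := hu
    rw [hV, Finset.mem_image] at huV
    obtain ⟨i, -, rfl⟩ := huV
    rw [Finset.mem_erase, Finset.mem_range]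
    exact ⟨hu0, Nat.lt_succ_of_le (hcvle i)⟩
  have hWcard : W.card ≤ 5 := by
    have hVK : V.card ≤ 6 := by
      have := Finset.card_image_le (s := (Finset.univ : Finset (Fin 6))) (f := cv)
      simpa using this
    have h1 : W.card + 1 = V.card := by rw [hW]; exact Finset.card_erase_add_one h0V
    omega
  obtain ⟨W', hWW', hW'sub, hW'card⟩ := Finset.exists_subsuperset_card_eq hWsub hWcard
    (by rw [Finset.card_erase_of_mem (by simp), Finset.card_range]; omega)
  have hVW' : ∀ u ∈ V, u = 0 ∨ u ∈ W' := by
    intro u hu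
    by_cases hu0 : u = 0
    · exact Or.inl hu0
    · exact Or.inr (hWW' (by rw [hW, Finset.mem_erase]; exact ⟨hu0, hu⟩))
  have hlmem : ∀ u, u ∈ Finset.sort W' ↔ u ∈ W' := fun u => Finset.mem_sort _
  have hlsort : (Finset.sort W').SortedLT := Finset.sortedLT_sort W'
  have hllen : (Finset.sort W').length = 5 := by rw [Finset.length_sort, hW'card]
  generalize hl : Finset.sort W' = l at hlmem hlsort hllen
  rcases l with _ | ⟨a, _ | ⟨b, _ | ⟨c, _ | ⟨e, _ | ⟨f, _ | ⟨zz, ll⟩⟩⟩⟩⟩⟩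
  all_goals simp only [List.length_cons, List.length_nil] at hllen
  all_goals try omega
  have hmemR : ∀ u, u ∈ [a, b, c, e, f] → u ∈ List.range 144 := by
    intro u hu
    have hu' : u ∈ W' := (hlmem u).mp hu
    have := hW'sub hu'
    rw [Finset.mem_erase, Finset.mem_range] at this
    exact List.mem_range.mpr this.2
  have hne0 : ∀ u, u ∈ [a, b, c, e, f] → u ≠ 0 := by
    intro u hu
    have hu' : u ∈ W' := (hlmem u).mp hu
    have := hW'sub hu'
    rw [Finset.mem_erase] at this
    exact this.1
  have h0 : 0 < a := Nat.pos_of_ne_zero (hne0 a (by simp))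
  have hmemP : ∀ r, r ≤ 142 → (∃ i j k l : Fin 6, d i + d j + d k + d l = r) → (∃ x ∈ [0, a, b, c, e, f], ∃ y ∈ [0, a, b, c, e, f], ∃ z ∈ [0, a, b, c, e, f], ∃ w ∈ [0, a, b, c, e, f], x + y + z + w = r) := by
    rintro r hr ⟨i, j, k, l, hsum⟩
    have hi : cv i = d i := hcvd i (by omega)
    have hj : cv j = d j := hcvd j (by omega)
    have hk : cv k = d k := hcvd k (by omega)
    have hl : cv l = d l := hcvd l (by omega)
    have hin : ∀ u ∈ V, u ∈ [0, a, b, c, e, f] := by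
      intro u hu
      rcases hVW' u hu with h | h
      · rw [h]; simp
      · exact List.mem_cons_of_mem _ ((hlmem u).mpr h)
    exact ⟨cv i, hin _ (hcvV i), cv j, hin _ (hcvV j), cv k, hin _ (hcvV k), cv l, hin _ (hcvV l), by rw [hi, hj, hk, hl]; exact hsum⟩
  have hchainP : ∀ r, r ≤ 139 → (∃ x ∈ [0, a, b, c, e, f], ∃ y ∈ [0, a, b, c, e, f], ∃ z ∈ [0, a, b, c, e, f], ∃ w ∈ [0, a, b, c, e, f], x + y + z + w = r) ∨ (∃ x ∈ [0, a, b, c, e, f], ∃ y ∈ [0, a, b, c, e, f], ∃ z ∈ [0, a, b, c, e, f], ∃ w ∈ [0, a, b, c, e, f], x + y + z + w = r + 1) := by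
    intro r hr
    rcases hchain r (by omega) with h | h
    · exact Or.inl (hmemP r (by omega) h)
    · exact Or.inr (hmemP (r + 1) (by omega) h)
  have hfull : ((List.foldr (fun x acc => acc ||| (List.foldr (fun x acc => acc ||| (List.foldr (fun x acc => acc ||| (List.foldr (fun y acc => acc ||| 2 ^ y) 0 [0, a, b, c, e, f]) * 2 ^ x) 0 [0, a, b, c, e, f]) * 2 ^ x) 0 [0, a, b, c, e, f]) * 2 ^ x) 0 [0, a, b, c, e, f] ||| List.foldr (fun x acc => acc ||| (List.foldr (fun x acc => acc ||| (List.foldr (fun x acc => acc ||| (List.foldr (fun y acc => acc ||| 2 ^ y) 0 [0, a, b, c, e, f]) * 2 ^ x) 0 [0, a, b, c, e, f]) * 2 ^ x) 0 [0, a, b, c, e, f]) * 2 ^ x) 0 [0, a, b, c, e, f] / 2) % 2 ^ 140 = 2 ^ 140 - 1) := by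
    apply maskAlive_of_testBit
    intro r hr
    rcases hchainP r (by omega) with h | h
    · exact Or.inl (testBit_fold4Shift_of_mem h)
    · exact Or.inr (testBit_fold4Shift_of_mem h)
  have hlt1 : a < b := by
    have := hlsort (show (⟨0, by simp⟩ : Fin [a, b, c, e, f].length) < ⟨1, by simp⟩ from Fin.mk_lt_mk.mpr (by norm_num))
    simpa using this
  have hlt2 : b < c := by
    have := hlsort (show (⟨1, by simp⟩ : Fin [a, b, c, e, f].length) < ⟨2, by simp⟩ from Fin.mk_lt_mk.mpr (by norm_num))
    simpa using this
  have hlt3 : c < e := by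
    have := hlsort (show (⟨2, by simp⟩ : Fin [a, b, c, e, f].length) < ⟨3, by simp⟩ from Fin.mk_lt_mk.mpr (by norm_num))
    simpa using this
  have hlt4 : e < f := by
    have := hlsort (show (⟨3, by simp⟩ : Fin [a, b, c, e, f].length) < ⟨4, by simp⟩ from Fin.mk_lt_mk.mpr (by norm_num))
    simpa using this
  -- the two smallest positive values: `a ≤ 2` (chain at `1`) and `b ≤ 4a + 2` (chain at `4a + 1`)
  have hrestA : ∀ y ∈ [a, b, c, e, f], a ≤ y := by
    intro y hy
    simp only [List.mem_cons, List.mem_nil_iff, or_false] at hy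
    omega
  have hrestB : ∀ y ∈ [b, c, e, f], b ≤ y := by
    intro y hy
    simp only [List.mem_cons, List.mem_nil_iff, or_false] at hy
    omega
  have ha2 : a ≤ 2 := by
    by_contra hh
    rcases hchainP 1 (by omega) with h | h
    · obtain ⟨x, hx, y, hy, z, hz, w, hw, hsum⟩ := memP4_prefix (l₁ := [0]) (l₂ := [a, b, c, e, f]) hrestA (by omega) h
      simp only [List.mem_cons, List.mem_nil_iff, or_false] at hx hy hz hw
      omega
    · obtain ⟨x, hx, y, hy, z, hz, w, hw, hsum⟩ := memP4_prefix (l₁ := [0]) (l₂ := [a, b, c, e, f]) hrestA (by omega) h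
      simp only [List.mem_cons, List.mem_nil_iff, or_false] at hx hy hz hw
      omega
  have hb2 : b ≤ 4 * a + 2 := by
    by_contra hh
    rcases hchainP (4 * a + 1) (by omega) with h | h
    · obtain ⟨x, hx, y, hy, z, hz, w, hw, hsum⟩ := memP4_prefix (l₁ := [0, a]) (l₂ := [b, c, e, f]) hrestB (by omega) h
      simp only [List.mem_cons, List.mem_nil_iff, or_false] at hx hy hz hw
      rcases hx with rfl | rfl <;> rcases hy with rfl | rfl <;> rcases hz with rfl | rfl <;> rcases hw with rfl | rfl <;> omega
    · obtain ⟨x, hx, y, hy, z, hz, w, hw, hsum⟩ := memP4_prefix (l₁ := [0, a]) (l₂ := [b, c, e, f]) hrestB (by omega) h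
      simp only [List.mem_cons, List.mem_nil_iff, or_false] at hx hy hz hw
      rcases hx with rfl | rfl <;> rcases hy with rfl | rfl <;> rcases hz with rfl | rfl <;> rcases hw with rfl | rfl <;> omega
  have pre3 : ((List.foldr (fun x acc => acc ||| (List.foldr (fun x acc => acc ||| (List.foldr (fun x acc => acc ||| (List.foldr (fun y acc => acc ||| 2 ^ y) 0 [0, a, b]) * 2 ^ x) 0 [0, a, b]) * 2 ^ x) 0 [0, a, b]) * 2 ^ x) 0 [0, a, b] ||| List.foldr (fun x acc => acc ||| (List.foldr (fun x acc => acc ||| (List.foldr (fun x acc => acc ||| (List.foldr (fun y acc => acc ||| 2 ^ y) 0 [0, a, b]) * 2 ^ x) 0 [0, a, b]) * 2 ^ x) 0 [0, a, b]) * 2 ^ x) 0 [0, a, b] / 2) % 2 ^ (min 140 (c - 1)) = 2 ^ (min 140 (c - 1)) - 1) := by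
    apply maskAlive_of_testBit
    intro r hr
    have hrT : r < 140 := lt_of_lt_of_le hr (min_le_left _ _)
    have hrv : r < c - 1 := lt_of_lt_of_le hr (min_le_right _ _)
    have hr' : r + 1 < c := by omega
    have hrest : ∀ y ∈ [c, e, f], c ≤ y := by
      intro y hy
      simp only [List.mem_cons, List.mem_nil_iff, or_false] at hy
      omega
    rcases hchainP r (by omega) with h | h
    · exact Or.inl (testBit_fold4Shift_of_mem (memP4_prefix (l₁ := [0, a, b]) (l₂ := [c, e, f]) hrest (by omega) h))
    · exact Or.inr (testBit_fold4Shift_of_mem (memP4_prefix (l₁ := [0, a, b]) (l₂ := [c, e, f]) hrest hr' h))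
  have pre4 : ((List.foldr (fun x acc => acc ||| (List.foldr (fun x acc => acc ||| (List.foldr (fun x acc => acc ||| (List.foldr (fun y acc => acc ||| 2 ^ y) 0 [0, a, b, c]) * 2 ^ x) 0 [0, a, b, c]) * 2 ^ x) 0 [0, a, b, c]) * 2 ^ x) 0 [0, a, b, c] ||| List.foldr (fun x acc => acc ||| (List.foldr (fun x acc => acc ||| (List.foldr (fun x acc => acc ||| (List.foldr (fun y acc => acc ||| 2 ^ y) 0 [0, a, b, c]) * 2 ^ x) 0 [0, a, b, c]) * 2 ^ x) 0 [0, a, b, c]) * 2 ^ x) 0 [0, a, b, c] / 2) % 2 ^ (min 140 (e - 1)) = 2 ^ (min 140 (e - 1)) - 1) := by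
    apply maskAlive_of_testBit
    intro r hr
    have hrT : r < 140 := lt_of_lt_of_le hr (min_le_left _ _)
    have hrv : r < e - 1 := lt_of_lt_of_le hr (min_le_right _ _)
    have hr' : r + 1 < e := by omega
    have hrest : ∀ y ∈ [e, f], e ≤ y := by
      intro y hy
      simp only [List.mem_cons, List.mem_nil_iff, or_false] at hy
      omega
    rcases hchainP r (by omega) with h | h
    · exact Or.inl (testBit_fold4Shift_of_mem (memP4_prefix (l₁ := [0, a, b, c]) (l₂ := [e, f]) hrest (by omega) h))
    · exact Or.inr (testBit_fold4Shift_of_mem (memP4_prefix (l₁ := [0, a, b, c]) (l₂ := [e, f]) hrest hr' h))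
  have pre5 : ((List.foldr (fun x acc => acc ||| (List.foldr (fun x acc => acc ||| (List.foldr (fun x acc => acc ||| (List.foldr (fun y acc => acc ||| 2 ^ y) 0 [0, a, b, c, e]) * 2 ^ x) 0 [0, a, b, c, e]) * 2 ^ x) 0 [0, a, b, c, e]) * 2 ^ x) 0 [0, a, b, c, e] ||| List.foldr (fun x acc => acc ||| (List.foldr (fun x acc => acc ||| (List.foldr (fun x acc => acc ||| (List.foldr (fun y acc => acc ||| 2 ^ y) 0 [0, a, b, c, e]) * 2 ^ x) 0 [0, a, b, c, e]) * 2 ^ x) 0 [0, a, b, c, e]) * 2 ^ x) 0 [0, a, b, c, e] / 2) % 2 ^ (min 140 (f - 1)) = 2 ^ (min 140 (f - 1)) - 1) := by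
    apply maskAlive_of_testBit
    intro r hr
    have hrT : r < 140 := lt_of_lt_of_le hr (min_le_left _ _)
    have hrv : r < f - 1 := lt_of_lt_of_le hr (min_le_right _ _)
    have hr' : r + 1 < f := by omega
    have hrest : ∀ y ∈ [f], f ≤ y := by
      intro y hy
      simp only [List.mem_cons, List.mem_nil_iff, or_false] at hy
      omega
    rcases hchainP r (by omega) with h | h
    · exact Or.inl (testBit_fold4Shift_of_mem (memP4_prefix (l₁ := [0, a, b, c, e]) (l₂ := [f]) hrest (by omega) h))
    · exact Or.inr (testBit_fold4Shift_of_mem (memP4_prefix (l₁ := [0, a, b, c, e]) (l₂ := [f]) hrest hr' h))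
  obtain ⟨hnoT1, hnoT0T2⟩ :
      ((List.foldr (fun x acc => acc ||| (List.foldr (fun x acc => acc ||| (List.foldr (fun x acc => acc ||| (List.foldr (fun y acc => acc ||| 2 ^ y) 0 [0, a, b, c, e, f]) * 2 ^ x) 0 [0, a, b, c, e, f]) * 2 ^ x) 0 [0, a, b, c, e, f]) * 2 ^ x) 0 [0, a, b, c, e, f]).testBit 141 = false ∧ ((List.foldr (fun x acc => acc ||| (List.foldr (fun x acc => acc ||| (List.foldr (fun x acc => acc ||| (List.foldr (fun y acc => acc ||| 2 ^ y) 0 [0, a, b, c, e, f]) * 2 ^ x) 0 [0, a, b, c, e, f]) * 2 ^ x) 0 [0, a, b, c, e, f]) * 2 ^ x) 0 [0, a, b, c, e, f]).testBit 140 = false ∨ (List.foldr (fun x acc => acc ||| (List.foldr (fun x acc => acc ||| (List.foldr (fun x acc => acc ||| (List.foldr (fun y acc => acc ||| 2 ^ y) 0 [0, a, b, c, e, f]) * 2 ^ x) 0 [0, a, b, c, e, f]) * 2 ^ x) 0 [0, a, b, c, e, f]) * 2 ^ x) 0 [0, a, b, c, e, f]).testBit 142 = false)) := by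
    interval_cases a <;> interval_cases b
    · exact sectorCheck_four_six_s12 c (hmemR c (by simp)) ⟨hlt2, pre3⟩ e (hmemR e (by simp)) ⟨hlt3, pre4⟩ f (hmemR f (by simp)) ⟨hlt4, pre5⟩ hfull
    · exact sectorCheck_four_six_s13 c (hmemR c (by simp)) ⟨hlt2, pre3⟩ e (hmemR e (by simp)) ⟨hlt3, pre4⟩ f (hmemR f (by simp)) ⟨hlt4, pre5⟩ hfull
    · exact sectorCheck_four_six_s14 c (hmemR c (by simp)) ⟨hlt2, pre3⟩ e (hmemR e (by simp)) ⟨hlt3, pre4⟩ f (hmemR f (by simp)) ⟨hlt4, pre5⟩ hfull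
    · exact sectorCheck_four_six_s15 c (hmemR c (by simp)) ⟨hlt2, pre3⟩ e (hmemR e (by simp)) ⟨hlt3, pre4⟩ f (hmemR f (by simp)) ⟨hlt4, pre5⟩ hfull
    · exact sectorCheck_four_six_s16 c (hmemR c (by simp)) ⟨hlt2, pre3⟩ e (hmemR e (by simp)) ⟨hlt3, pre4⟩ f (hmemR f (by simp)) ⟨hlt4, pre5⟩ hfull
    · exact sectorCheck_four_six_s23 c (hmemR c (by simp)) ⟨hlt2, pre3⟩ e (hmemR e (by simp)) ⟨hlt3, pre4⟩ f (hmemR f (by simp)) ⟨hlt4, pre5⟩ hfull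
    · exact sectorCheck_four_six_s24 c (hmemR c (by simp)) ⟨hlt2, pre3⟩ e (hmemR e (by simp)) ⟨hlt3, pre4⟩ f (hmemR f (by simp)) ⟨hlt4, pre5⟩ hfull
    · exact sectorCheck_four_six_s25 c (hmemR c (by simp)) ⟨hlt2, pre3⟩ e (hmemR e (by simp)) ⟨hlt3, pre4⟩ f (hmemR f (by simp)) ⟨hlt4, pre5⟩ hfull
    · exact sectorCheck_four_six_s26 c (hmemR c (by simp)) ⟨hlt2, pre3⟩ e (hmemR e (by simp)) ⟨hlt3, pre4⟩ f (hmemR f (by simp)) ⟨hlt4, pre5⟩ hfull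
    · exact sectorCheck_four_six_s27 c (hmemR c (by simp)) ⟨hlt2, pre3⟩ e (hmemR e (by simp)) ⟨hlt3, pre4⟩ f (hmemR f (by simp)) ⟨hlt4, pre5⟩ hfull
    · exact sectorCheck_four_six_s28 c (hmemR c (by simp)) ⟨hlt2, pre3⟩ e (hmemR e (by simp)) ⟨hlt3, pre4⟩ f (hmemR f (by simp)) ⟨hlt4, pre5⟩ hfull
    · exact sectorCheck_four_six_s29 c (hmemR c (by simp)) ⟨hlt2, pre3⟩ e (hmemR e (by simp)) ⟨hlt3, pre4⟩ f (hmemR f (by simp)) ⟨hlt4, pre5⟩ hfull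
    · exact sectorCheck_four_six_s210 c (hmemR c (by simp)) ⟨hlt2, pre3⟩ e (hmemR e (by simp)) ⟨hlt3, pre4⟩ f (hmemR f (by simp)) ⟨hlt4, pre5⟩ hfull
  have hcontra : ∀ r, r ≤ 142 → (∃ i j k l : Fin 6, d i + d j + d k + d l = r) → (List.foldr (fun x acc => acc ||| (List.foldr (fun x acc => acc ||| (List.foldr (fun x acc => acc ||| (List.foldr (fun y acc => acc ||| 2 ^ y) 0 [0, a, b, c, e, f]) * 2 ^ x) 0 [0, a, b, c, e, f]) * 2 ^ x) 0 [0, a, b, c, e, f]) * 2 ^ x) 0 [0, a, b, c, e, f]).testBit r = false → False := by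
    intro r hr h hf
    have hb := testBit_fold4Shift_of_mem (hmemP r hr h)
    rw [hf] at hb
    exact Bool.false_ne_true hb
  rcases Nat.lt_or_ge (pencil d S).det.natDegree 143 with hsmall | hbig
  · interval_cases h : (pencil d S).det.natDegree
    · exact hcontra 141 (by omega) htop hnoT1
    · rcases hchain 140 (by omega) with h' | h'
      · rcases hnoT0T2 with hf | hf
        · exact hcontra 140 (by omega) h' hf
        · exact hcontra 142 (by omega) htop hf
      · exact hcontra 141 (by omega) h' hnoT1
  · rcases hchain 140 (by omega) with h1 | h1
    · rcases hchain 141 (by omega) with h2 | h2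
      · exact hcontra 141 (by omega) h2 hnoT1
      · rcases hnoT0T2 with hf | hf
        · exact hcontra 140 (by omega) h1 hf
        · exact hcontra 142 (by omega) h2 hf
    · exact hcontra 141 (by omega) h1 hnoT1

end Summit.ValiantsHypothesis.ValiantsHypothesis.Theorems.LacunarySymmetroidMatrixDescartes.FiniteSector
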